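import Literature.NumberTheory.LFunctions.ExceptionalZeroPrimeSums
import Literature.NumberTheory.LFunctions.GranvilleMollinLinnikZeros
import Literature.NumberTheory.LFunctions.PagePNTExceptionalData
import Literature.NumberTheory.LFunctions.PrimitiveQuadraticCharacter
import HarnessLib

/-!
# Three estimates for Granville–Mollin's (3.3): `θ(x; (·/q))` versus `ψ(x, χ)`, the constant
# `C(χ)`, and the sum over the zeros other than `β`, `1 − β`

Topic `Literature/NumberTheory/LFunctions`, sub-namespace `SiegelZero`. Everything in this file is
PROVED (theorems only). With `χ` the primitive quadratic character mod `q` (`q` odd square-free,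
so `χ(n) = (n/q)`, `Literature.NumberTheory.LFunctions.PrimitiveQuadratic.apply_natCast_eq_jacobiSym`)
and `β` its exceptional real zero, these are the three inputs, besides the named facts
`Literature.NumberTheory.LFunctions.truncatedExplicitFormula_psiChar` (MV Thm. 12.10) and
`Literature.NumberTheory.LFunctions.GranvilleMollin2000_eq32` (GM (3.2)), of the deduction of
`Literature.NumberTheory.LFunctions.SiegelZero.GranvilleMollin2000_eq33` carried out in
`GranvilleMollinLinnikProofs.lean`:

* `abs_jacobiTheta_sub_re_le` — `|θ(x; (·/q)) − Re ψ(x, χ)| ≤ ψ(x) − θ(x) ≤ 2√x log x`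
  (the prime powers `pᵏ`, `k ≥ 2`; Mathlib's `Chebyshev.psi_sub_theta_le`);
* `exists_norm_explicitFormulaConst_le` — `|C(χ)| ≤ C₅ (log q + 7)⁴ (1/(1 − β) + 1)` when `β` is
  an exceptional zero (MV Theorem 11.4 in the tree's crude form
  `Literature.NumberTheory.LFunctions.DirichletZFR.exists_norm_logDeriv_le_of_re_ge` at `s = 1`,
  packaged by `Literature.NumberTheory.LFunctions.PagePNT.exc_facts`; MV after Cor. 12.11:
  "`C(χ) = 1/(1 − β₁) + O(log q)` if `L(s, χ)` has the exceptional zero `β₁`");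
* `norm_charZeroSumTrunc_sub_le` — splitting `∑_{|γ| ≤ T} m(ρ) x^ρ/ρ = x^β/β + x^{1−β}/(1 − β) +
  ∑_{ρ ≠ β, 1−β}` and bounding the last sum by `4 ∑_{ρ ≠ β} m(ρ) x^{Re ρ}` (the zeros with
  `|ρ| ≥ 1/4`) plus `x^{1/4} r₀⁻¹ B` (the zeros with `Re ρ, |Im ρ| < 1/4`, which have `|ρ| ≥ r₀`
  and whose partners `1 − ρ` lie in the Jensen disc `|s − 2| ≤ 13/10`, of total multiplicity
  `≤ B`).

## References

* A. Granville, R. A. Mollin, *Rabinowitsch revisited*, Acta Arith. 96 (2000), §3 (3.1)–(3.3)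
  (`GranvilleMollin2000`).
* H. L. Montgomery, R. C. Vaughan, *Multiplicative Number Theory I*, CUP 2007, Theorem 11.4,
  Corollary 12.11 and (12.11) (`MontgomeryVaughan2007`).
-/

noncomputable section

open Complex Filter Topology Metric Set Finset
open scoped Real ArithmeticFunction.vonMangoldt

namespace Literature.NumberTheory.LFunctions.SiegelZero

open Literature.NumberTheory.LFunctions.DirichletZFR DirichletCharacter
open Literature.NumberTheory.Sieve (chebyshevPsiChar)

/-! ## `θ(x; (·/q))` and `ψ(x, χ)` -/

/-- **The prime sum of the Jacobi symbol is the real part of `ψ(x, χ)` up to the prime powers**: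
for `q` odd and square-free and `χ` the primitive quadratic character mod `q` (`χ(n) = (n/q)`),
`|θ(x; (·/q)) − Re ψ(x, χ)| ≤ ψ(x) − θ(x) ≤ 2√x log x` for `x ≥ 1`. [folklore] -/
theorem abs_jacobiTheta_sub_re_le {q : ℕ} [NeZero q] (hodd : Odd q) (hsq : Squarefree q)
    (χ : DirichletCharacter ℂ q) (hprim : χ.IsPrimitive) (hquad : χ.IsQuadratic) {x : ℝ}
    (hx : 1 ≤ x) :
    |jacobiTheta q x - (chebyshevPsiChar χ x).re| ≤ 2 * Real.sqrt x * Real.log x := by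
  classical
  set N := ⌊x⌋₊ with hN
  -- `Re ψ(x, χ)` as a sum over `Icc 0 N`
  have hrange : Finset.range (N + 1) = Finset.Icc 0 N := by
    ext n; simp
  have hre : (chebyshevPsiChar χ x).re = ∑ n ∈ Finset.Icc 0 N, (χ n).re * Λ n := by
    rw [chebyshevPsiChar, ← hN, hrange, Complex.re_sum]
    refine sum_congr rfl fun n _ ↦ ?_
    simp [Complex.mul_re]
  -- split into primes and non-primes
  have hsplit := (sum_filter_add_sum_filter_not (Finset.Icc 0 N) Nat.Prime
    (fun n ↦ (χ n).re * Λ n)).symm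
  have hprime : ∑ n ∈ (Finset.Icc 0 N).filter Nat.Prime, (χ n).re * Λ n = jacobiTheta q x := by
    rw [jacobiTheta, ← hN, Nat.primesLE_eq_filter_Icc_zero]
    refine sum_congr rfl fun p hp ↦ ?_
    have hp' : p.Prime := (mem_filter.1 hp).2
    rw [ArithmeticFunction.vonMangoldt_apply_prime hp',
      Literature.NumberTheory.LFunctions.PrimitiveQuadratic.apply_natCast_eq_jacobiSym hodd hsq χ
        hprim hquad p, Complex.intCast_re]
  have hnonprime : |∑ n ∈ (Finset.Icc 0 N).filter (fun n ↦ ¬ n.Prime), (χ n).re * Λ n| ≤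
      Chebyshev.psi x - Chebyshev.theta x := by
    have hpsi : Chebyshev.psi x - Chebyshev.theta x =
        ∑ n ∈ (Finset.Icc 0 N).filter (fun n ↦ ¬ n.Prime), (Λ n : ℝ) := by
      rw [Chebyshev.psi_eq_sum_Icc, Chebyshev.theta_eq_sum_Icc, ← hN, sum_filter, sum_filter,
        ← sum_sub_distrib]
      refine sum_congr rfl fun n _ ↦ ?_
      split_ifs with h
      · simp [ArithmeticFunction.vonMangoldt_apply_prime h]
      · simp
    rw [hpsi]
    refine (abs_sum_le_sum_abs _ _).trans (sum_le_sum fun n _ ↦ ?_)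
    rw [abs_mul, abs_of_nonneg ArithmeticFunction.vonMangoldt_nonneg]
    refine mul_le_of_le_one_left ArithmeticFunction.vonMangoldt_nonneg ?_
    exact (Complex.abs_re_le_norm _).trans (χ.norm_le_one _)
  have hkey : jacobiTheta q x - (chebyshevPsiChar χ x).re =
      -∑ n ∈ (Finset.Icc 0 N).filter (fun n ↦ ¬ n.Prime), (χ n).re * Λ n := by
    rw [hre, hsplit, hprime]; ring
  rw [hkey, abs_neg]
  exact hnonprime.trans (Chebyshev.psi_sub_theta_le hx)

/-! ## The constant `C(χ)` -/

/-- `log 4 ≤ 2` and `0 < log 4`. [folklore] -/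
theorem log_four_le_two : Real.log 4 ≤ 2 ∧ 0 < Real.log 4 := by
  constructor
  · have h : Real.log 4 = 2 * Real.log 2 := by
      rw [show (4 : ℝ) = 2 ^ 2 by norm_num, Real.log_pow]; norm_num
    rw [h]; linarith [Real.log_two_lt_d9]
  · exact Real.log_pos (by norm_num)

/-- **The constant of the explicit formula at an exceptional zero**: there are absolute `c_E > 0`
and `C₅ ≥ 0` such that for every quadratic `χ ≠ χ₀` mod `q` with a real zero
`β > 1 − c_E/(log q + log 4)` of `L(s, χ)`,
`|C(χ)| ≤ C₅ (log q + 7)⁴ (1/(1 − β) + 1)`, `C(χ) = L'/L(1, χ) + log(q/2π) − C₀`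
(`Literature.NumberTheory.LFunctions.explicitFormulaConst`). This is the crude form of
"`C(χ) = 1/(1 − β₁) + O(log q)`" (MV after Cor. 12.11, from Theorem 11.4) given by the tree's
`L'/L` bound `Literature.NumberTheory.LFunctions.PagePNT.exc_facts` at `s = 1`.
[cite: MontgomeryVaughan2007, Corollary 12.11 and Theorem 11.4] -/
theorem exists_norm_explicitFormulaConst_le :
    ∃ cE : ℝ, 0 < cE ∧ ∃ C₅ : ℝ, 0 ≤ C₅ ∧ ∀ (q : ℕ) [NeZero q] (χ : DirichletCharacter ℂ q),
      χ ≠ 1 → χ.IsQuadratic → ∀ β : ℝ, χ.LFunction β = 0 →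
        1 - cE / (Real.log q + Real.log 4) < β →
          ‖explicitFormulaConst χ‖ ≤ C₅ * (Real.log q + 7) ^ 4 * (1 / (1 - β) + 1) := by
  obtain ⟨c₃, hc₃, C₃, hC₃, -, hL⟩ := exists_norm_logDeriv_le_of_re_ge
  obtain ⟨cP, hcP, hP⟩ := exists_min_realZeros_le
  obtain ⟨hl4, hl4pos⟩ := log_four_le_two
  refine ⟨cP / 2, half_pos hcP, C₃ * Real.log 4 * (2 / cP + 1) + 1, by positivity,
    fun q _ χ hχ hquad β hβ hβc ↦ ?_⟩
  have hq1 : (1 : ℝ) ≤ q := by exact_mod_cast NeZero.one_le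
  have hq0 : (0 : ℝ) < q := by linarith
  have hlogq : 0 ≤ Real.log q := Real.log_nonneg hq1
  set ℒ₀ := Real.log q + Real.log 4 with hℒ₀
  have hℒ₀1 : 1 ≤ ℒ₀ := Literature.NumberTheory.LFunctions.PagePNT.one_le_ell0 q
  have hℒ₀0 : 0 < ℒ₀ := by linarith
  have hℒ₀7 : ℒ₀ ≤ Real.log q + 7 := by rw [hℒ₀]; linarith
  -- `β < 1`
  have hβ1 : β < 1 := by
    by_contra h
    push Not at h
    exact LFunction_ne_zero_of_one_le_re χ (Or.inl hχ) (by simpa using h) hβ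
  have h1β : 0 < 1 - β := by linarith
  -- the `L'/L` bound at `s = 1`
  have hsβ : (1 : ℂ) ≠ (β : ℂ) := by
    intro h; have := congrArg Complex.re h; simp at this; linarith
  have hs₃ : 1 - c₃ / (Real.log q + Real.log (|(1 : ℂ).im| + 4)) ≤ (1 : ℂ).re := by
    simp only [Complex.one_im, abs_zero, zero_add, Complex.one_re]
    have : 0 < c₃ / (Real.log q + Real.log 4) := by positivity
    linarith
  have hs : 1 - cP / 2 / (Real.log q + Real.log 4) < (1 : ℂ).re := by
    simp only [Complex.one_re]
    have : 0 < cP / 2 / (Real.log q + Real.log 4) := by positivity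
    linarith
  have hc : cP / 2 ≤ min cP cP / 2 := by rw [min_self]
  obtain ⟨-, hbound⟩ := Literature.NumberTheory.LFunctions.PagePNT.exc_facts (c₃ := c₃) (C₃ := C₃)
    (cP := cP) (cL := cP) hL hP hcP hcP hχ hβ hc hβc hsβ hs₃ hs
  simp only [Complex.one_im, abs_zero, zero_add, min_self] at hbound
  -- the distance `d`
  set d : ℝ := min (min ‖(1 : ℂ) - (β : ℂ)‖ (cP / (2 * ℒ₀))) 1 with hd
  have hnorm : ‖(1 : ℂ) - (β : ℂ)‖ = 1 - β := by
    rw [show (1 : ℂ) - (β : ℂ) = ((1 - β : ℝ) : ℂ) by push_cast; ring, Complex.norm_real,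
      Real.norm_of_nonneg h1β.le]
  have hdpos : 0 < d := by rw [hd, hnorm]; positivity
  have hdinv : d⁻¹ ≤ 1 / (1 - β) + 2 * ℒ₀ / cP + 1 := by
    rw [hd, hnorm]
    calc (min (min (1 - β) (cP / (2 * ℒ₀))) 1)⁻¹
        ≤ (min (1 - β) (cP / (2 * ℒ₀)))⁻¹ + 1⁻¹ :=
          Literature.NumberTheory.LFunctions.PagePNT.inv_min_le (lt_min h1β (by positivity))
            one_pos
      _ ≤ ((1 - β)⁻¹ + (cP / (2 * ℒ₀))⁻¹) + 1⁻¹ := by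
          gcongr
          exact Literature.NumberTheory.LFunctions.PagePNT.inv_min_le h1β (by positivity)
      _ = 1 / (1 - β) + 2 * ℒ₀ / cP + 1 := by
          rw [inv_div, one_div, inv_one]
  have hLL : ‖deriv χ.LFunction 1 / χ.LFunction 1‖ ≤
      C₃ * Real.log 4 * ℒ₀ ^ 3 * (1 / (1 - β) + 2 * ℒ₀ / cP + 1) := by
    calc ‖deriv χ.LFunction 1 / χ.LFunction 1‖ ≤ C₃ * (ℒ₀ ^ 3 / d) * Real.log 4 := hbound
      _ = C₃ * Real.log 4 * ℒ₀ ^ 3 * d⁻¹ := by rw [div_eq_mul_inv]; ring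
      _ ≤ C₃ * Real.log 4 * ℒ₀ ^ 3 * (1 / (1 - β) + 2 * ℒ₀ / cP + 1) := by gcongr
  -- the elementary terms `log(q/2π)` and `C₀`
  have hlog2pi : ‖((Real.log (q / (2 * π)) : ℝ) : ℂ)‖ ≤ Real.log q + 6 := by
    rw [Complex.norm_real, Real.norm_eq_abs, Real.log_div hq0.ne' (by positivity)]
    have h2pi : 0 ≤ Real.log (2 * π) := Real.log_nonneg (by linarith [Real.pi_gt_three])
    have h2pi' : Real.log (2 * π) ≤ 6 := by
      have := Real.log_le_sub_one_of_pos (show (0 : ℝ) < 2 * π by positivity)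
      linarith [Real.pi_lt_d2]
    rw [abs_le]; constructor <;> linarith
  have hγ : ‖((Real.eulerMascheroniConstant : ℝ) : ℂ)‖ ≤ 1 := by
    rw [Complex.norm_real, Real.norm_of_nonneg]
    · linarith [Real.eulerMascheroniConstant_lt_two_thirds]
    · linarith [Real.one_half_lt_eulerMascheroniConstant]
  -- assemble
  have hmain : ‖explicitFormulaConst χ‖ ≤
      C₃ * Real.log 4 * ℒ₀ ^ 3 * (1 / (1 - β) + 2 * ℒ₀ / cP + 1) + (Real.log q + 7) := by
    rw [explicitFormulaConst, hquad.inv]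
    calc ‖deriv χ.LFunction 1 / χ.LFunction 1 + ((Real.log (q / (2 * π)) : ℝ) : ℂ) -
            (Real.eulerMascheroniConstant : ℂ)‖
        ≤ ‖deriv χ.LFunction 1 / χ.LFunction 1‖ + ‖((Real.log (q / (2 * π)) : ℝ) : ℂ)‖ +
            ‖((Real.eulerMascheroniConstant : ℝ) : ℂ)‖ := by
          have h1 := norm_sub_le (deriv χ.LFunction 1 / χ.LFunction 1 +
            ((Real.log (q / (2 * π)) : ℝ) : ℂ)) (Real.eulerMascheroniConstant : ℂ)
          have h2 := norm_add_le (deriv χ.LFunction 1 / χ.LFunction 1)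
            ((Real.log (q / (2 * π)) : ℝ) : ℂ)
          linarith
      _ ≤ _ := by linarith
  -- compare with `C₅ (log q + 7)^4 (1/(1-β) + 1)`
  set M : ℝ := Real.log q + 7 with hM
  have hM1 : 1 ≤ M := by rw [hM]; linarith
  have hA : 0 < 1 / (1 - β) := by positivity
  have h1 : ℒ₀ ^ 3 * (1 / (1 - β) + 2 * ℒ₀ / cP + 1) ≤ M ^ 4 * (2 / cP + 1) * (1 / (1 - β) + 1) := by
    have hℒM : ℒ₀ ^ 3 ≤ M ^ 3 := pow_le_pow_left₀ hℒ₀0.le hℒ₀7 3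
    have h2 : 1 / (1 - β) + 2 * ℒ₀ / cP + 1 ≤ M * (2 / cP + 1) * (1 / (1 - β) + 1) := by
      have : 2 * ℒ₀ / cP ≤ 2 * M / cP := by gcongr
      have h3 : 1 / (1 - β) + 2 * M / cP + 1 ≤ M * (2 / cP + 1) * (1 / (1 - β) + 1) := by
        have e : M * (2 / cP + 1) * (1 / (1 - β) + 1) =
            2 * M / cP * (1 / (1 - β)) + 2 * M / cP + M * (1 / (1 - β)) + M := by ring
        rw [e]
        have : 0 ≤ 2 * M / cP * (1 / (1 - β)) := by positivity
        nlinarith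
      linarith
    calc ℒ₀ ^ 3 * (1 / (1 - β) + 2 * ℒ₀ / cP + 1) ≤ M ^ 3 * (M * (2 / cP + 1) * (1 / (1 - β) + 1)) :=
          mul_le_mul hℒM h2 (by positivity) (by positivity)
      _ = M ^ 4 * (2 / cP + 1) * (1 / (1 - β) + 1) := by ring
  have h2 : M ≤ M ^ 4 * (1 / (1 - β) + 1) := by
    have : M ≤ M ^ 4 := by
      calc M = M ^ 1 := (pow_one M).symm
        _ ≤ M ^ 4 := pow_le_pow_right₀ hM1 (by norm_num)
    nlinarith [pow_nonneg (by linarith : (0 : ℝ) ≤ M) 4]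
  calc ‖explicitFormulaConst χ‖ ≤ C₃ * Real.log 4 * ℒ₀ ^ 3 * (1 / (1 - β) + 2 * ℒ₀ / cP + 1) + M :=
        hmain
    _ = C₃ * Real.log 4 * (ℒ₀ ^ 3 * (1 / (1 - β) + 2 * ℒ₀ / cP + 1)) + M := by ring
    _ ≤ C₃ * Real.log 4 * (M ^ 4 * (2 / cP + 1) * (1 / (1 - β) + 1)) + M ^ 4 * (1 / (1 - β) + 1) := by
        gcongr
    _ = (C₃ * Real.log 4 * (2 / cP + 1) + 1) * M ^ 4 * (1 / (1 - β) + 1) := by ring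

/-! ## The zeros other than `β` and `1 − β` -/

/-- A point with `Re z ≥ 1/4` or `|Im z| ≥ 1/4` has `|z| ≥ 1/4`. [folklore] -/
theorem quarter_le_norm {z : ℂ} (h : ¬(z.re < 1 / 4 ∧ |z.im| < 1 / 4)) : 1 / 4 ≤ ‖z‖ := by
  rcases not_and_or.1 h with h | h
  · push Not at h; exact h.trans (Complex.re_le_norm z)
  · push Not at h; exact h.trans (Complex.abs_im_le_norm z)

/-- The partner `1 − ρ` of a zero with `0 < Re ρ < 1/4`, `|Im ρ| < 1/4` lies in the Jensen disc
`|s − 2| ≤ 13/10`. [folklore] -/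
theorem norm_one_sub_sub_two_le {ρ : ℂ} (h0 : 0 < ρ.re) (hre : ρ.re < 1 / 4) (him : |ρ.im| < 1 / 4) :
    ‖(1 - ρ) - 2‖ ≤ 13 / 10 := by
  have e : (1 - ρ) - 2 = -(ρ + 1) := by ring
  rw [e, norm_neg]
  have hsq : ‖ρ + 1‖ ^ 2 ≤ (13 / 10) ^ 2 := by
    rw [Complex.sq_norm, Complex.normSq_apply]
    simp only [Complex.add_re, Complex.one_re, Complex.add_im, Complex.one_im, add_zero]
    have h1 := abs_lt.1 him
    nlinarith
  exact le_of_pow_le_pow_left₀ two_ne_zero (by norm_num) hsq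

/-- **The sum over the zeros other than `β`, `1 − β`.** Let `χ ≠ χ₀` be primitive quadratic mod
`q` with the simple real zero `β ∈ (1/2, 1)`; suppose every zero `ρ ≠ 1 − β` of `L(s, χ)` with
`0 < Re ρ < 1`, `|Im ρ| < 1` has `Re ρ ≥ r₀ > 0`, and every finite set of zeros in `|s − 2| ≤ 13/10`
(the disc `|s − (2 + 0·i)| ≤ 13/10` of the tree's Jensen count
`Literature.NumberTheory.LFunctions.DirichletDisc.exists_sum_zeroOrder_le_of_subset_closedBall`)
has total multiplicity `≤ B`. Then for `x ≥ 1`, `T ≥ 0`: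
`‖∑_{|γ| ≤ T} m(ρ)x^ρ/ρ − x^β/β − x^{1−β}/(1−β)‖ ≤ 4 ∑_{ρ ≠ β, |γ| ≤ T} m(ρ) x^{Re ρ} + x^{1/4} B/r₀`
(the zeros with `|ρ| ≥ 1/4` termwise; the others through their partners `1 − ρ`, MV Cor. 10.8,
which lie in the Jensen disc). [cite: GranvilleMollin2000, §3 (3.1)] -/
theorem norm_charZeroSumTrunc_sub_le {q : ℕ} [NeZero q] {χ : DirichletCharacter ℂ q} (hχ : χ ≠ 1)
    (hprim : χ.IsPrimitive) (hquad : χ.IsQuadratic) {β : ℝ} (hβ : χ.LFunction β = 0)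
    (hβhalf : 1 / 2 < β) (hβ1 : β < 1) (hmβ : DirichletDisc.zeroOrder χ β = 1) {r₀ : ℝ} (hr₀ : 0 < r₀)
    (hsmall : ∀ ρ : ℂ, χ.LFunction ρ = 0 → 0 < ρ.re → ρ.re < 1 → |ρ.im| < 1 → ρ ≠ 1 - β →
      r₀ ≤ ρ.re)
    {B : ℝ} (hcount : ∀ S : Finset ℂ,
      (∀ u ∈ S, u ∈ closedBall (2 + ((0 : ℝ) : ℂ) * I) (13 / 10) ∧ χ.LFunction u = 0) →
      (∑ ρ ∈ S, (DirichletDisc.zeroOrder χ ρ : ℝ)) ≤ B)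
    {x T : ℝ} (hx : 1 ≤ x) (hT : 0 ≤ T) :
    ‖charZeroSumTrunc χ x T - ((x ^ β / β : ℝ) : ℂ) - ((x ^ (1 - β) / (1 - β) : ℝ) : ℂ)‖ ≤
      4 * charZeroPowerSum χ x T {(β : ℂ)} + x ^ (1 / 4 : ℝ) / r₀ * B := by
  classical
  have hx0 : 0 < x := by linarith
  set F := (lfunctionZeroBox_finite hχ T).toFinset with hF
  set g : ℂ → ℂ := fun ρ ↦ (DirichletDisc.zeroOrder χ ρ : ℂ) * ((x : ℂ) ^ ρ / ρ) with hg
  set b' : ℂ := ((1 - β : ℝ) : ℂ) with hb'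
  have hb'eq : b' = 1 - (β : ℂ) := by rw [hb']; push_cast; ring
  -- membership of `β` and `1 - β`
  have hβF : (β : ℂ) ∈ F := by
    rw [hF, Set.Finite.mem_toFinset, mem_lfunctionZeroBox]
    exact ⟨hβ, by simp; linarith, by simp; linarith, by simp [hT]⟩
  have hb'zero : χ.LFunction b' = 0 := by
    rw [hb'eq]
    exact LFunction_one_sub_eq_zero hprim hquad hχ hβ (by simp; linarith) (by simp; linarith)
  have hb'F : b' ∈ F.erase (β : ℂ) := by
    rw [mem_erase, hF, Set.Finite.mem_toFinset, mem_lfunctionZeroBox]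
    refine ⟨?_, hb'zero, ?_, ?_, ?_⟩
    · rw [hb']; intro h; have := congrArg Complex.re h; simp at this; linarith
    · rw [hb']; simp; linarith
    · rw [hb']; simp; linarith
    · rw [hb']; simp [hT]
  have hmb' : DirichletDisc.zeroOrder χ b' = 1 := by
    rw [hb'eq, zeroOrder_one_sub hprim hquad hχ (by simp; linarith) (by simp; linarith),
      hmβ]
  -- the values of `g` at `β`, `1 - β`
  have hgβ : g β = ((x ^ β / β : ℝ) : ℂ) := by
    rw [hg]; simp only [hmβ, Nat.cast_one, one_mul]
    rw [Complex.ofReal_div, Complex.ofReal_cpow hx0.le]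
  have hgb' : g b' = ((x ^ (1 - β) / (1 - β) : ℝ) : ℂ) := by
    rw [hg]; simp only [hmb', Nat.cast_one, one_mul]
    rw [hb', Complex.ofReal_div, Complex.ofReal_cpow hx0.le]
  -- peel off the two zeros
  have hZ : charZeroSumTrunc χ x T = ∑ ρ ∈ F, g ρ := charZeroSumTrunc_eq hχ x T
  have hsum : ∑ ρ ∈ F, g ρ = g β + g b' + ∑ ρ ∈ (F.erase (β : ℂ)).erase b', g ρ := by
    rw [add_assoc, add_sum_erase _ _ hb'F, add_sum_erase _ _ hβF]
  have hdiff : charZeroSumTrunc χ x T - ((x ^ β / β : ℝ) : ℂ) - ((x ^ (1 - β) / (1 - β) : ℝ) : ℂ) =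
      ∑ ρ ∈ (F.erase (β : ℂ)).erase b', g ρ := by
    rw [hZ, hsum, hgβ, hgb']; ring
  rw [hdiff]
  -- termwise sizes
  have hRmem : ∀ ρ ∈ (F.erase (β : ℂ)).erase b',
      χ.LFunction ρ = 0 ∧ 0 < ρ.re ∧ ρ.re < 1 ∧ |ρ.im| ≤ T ∧ ρ ≠ β ∧ ρ ≠ b' := by
    intro ρ hρ
    rw [mem_erase, mem_erase, hF, Set.Finite.mem_toFinset, mem_lfunctionZeroBox] at hρ
    exact ⟨hρ.2.2.1, hρ.2.2.2.1, hρ.2.2.2.2.1, hρ.2.2.2.2.2, hρ.2.1, hρ.1⟩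
  have hnormg : ∀ ρ ∈ (F.erase (β : ℂ)).erase b',
      ‖g ρ‖ = (DirichletDisc.zeroOrder χ ρ : ℝ) * (x ^ ρ.re / ‖ρ‖) := by
    intro ρ _
    show ‖(DirichletDisc.zeroOrder χ ρ : ℂ) * ((x : ℂ) ^ ρ / ρ)‖ = _
    rw [norm_mul, Complex.norm_natCast, norm_div, Complex.norm_cpow_eq_rpow_re_of_pos hx0]
  set R := (F.erase (β : ℂ)).erase b' with hR
  let P : ℂ → Prop := fun ρ ↦ ρ.re < 1 / 4 ∧ |ρ.im| < 1 / 4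
  -- the zeros with `|ρ| ≥ 1/4`
  have hbig : ∑ ρ ∈ R.filter (fun ρ ↦ ¬P ρ), ‖g ρ‖ ≤ 4 * charZeroPowerSum χ x T {(β : ℂ)} := by
    have hsub : R.filter (fun ρ ↦ ¬P ρ) ⊆ F \ {(β : ℂ)} := by
      intro ρ hρ
      rw [mem_filter] at hρ
      rw [sdiff_singleton_eq_erase]
      exact mem_of_mem_erase hρ.1
    calc ∑ ρ ∈ R.filter (fun ρ ↦ ¬P ρ), ‖g ρ‖
        ≤ ∑ ρ ∈ R.filter (fun ρ ↦ ¬P ρ), 4 * ((DirichletDisc.zeroOrder χ ρ : ℝ) * x ^ ρ.re) := by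
          refine sum_le_sum fun ρ hρ ↦ ?_
          rw [mem_filter] at hρ
          rw [hnormg ρ hρ.1]
          have hq : 1 / 4 ≤ ‖ρ‖ := quarter_le_norm hρ.2
          have hpos : 0 < ‖ρ‖ := by linarith
          have hm : 0 ≤ (DirichletDisc.zeroOrder χ ρ : ℝ) * x ^ ρ.re :=
            mul_nonneg (Nat.cast_nonneg _) (Real.rpow_nonneg hx0.le _)
          rw [mul_div_assoc']
          rw [div_le_iff₀ hpos]
          nlinarith
      _ = 4 * ∑ ρ ∈ R.filter (fun ρ ↦ ¬P ρ), (DirichletDisc.zeroOrder χ ρ : ℝ) * x ^ ρ.re := by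
          rw [mul_sum]
      _ ≤ 4 * charZeroPowerSum χ x T {(β : ℂ)} := by
          rw [charZeroPowerSum_eq hχ, ← hF]
          exact mul_le_mul_of_nonneg_left (sum_le_sum_of_subset_of_nonneg hsub fun ρ _ _ ↦
            mul_nonneg (Nat.cast_nonneg _) (Real.rpow_nonneg hx0.le _)) (by norm_num)
  -- the zeros with `Re ρ, |Im ρ| < 1/4`
  have hsmallsum : ∑ ρ ∈ R.filter P, ‖g ρ‖ ≤ x ^ (1 / 4 : ℝ) / r₀ * B := by
    have hterm : ∀ ρ ∈ R.filter P, ‖g ρ‖ ≤ x ^ (1 / 4 : ℝ) / r₀ * (DirichletDisc.zeroOrder χ ρ : ℝ) := by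
      intro ρ hρ
      rw [mem_filter] at hρ
      obtain ⟨hre4, him4⟩ : ρ.re < 1 / 4 ∧ |ρ.im| < 1 / 4 := hρ.2
      obtain ⟨h0, hre0, hre1, -, -, hneb⟩ := hRmem ρ hρ.1
      rw [hnormg ρ hρ.1]
      have hr : r₀ ≤ ρ.re :=
        hsmall ρ h0 hre0 hre1 (by linarith) (by rw [← hb'eq]; exact hneb)
      have hρn : r₀ ≤ ‖ρ‖ := hr.trans (Complex.re_le_norm ρ)
      have hxre : x ^ ρ.re ≤ x ^ (1 / 4 : ℝ) :=
        Real.rpow_le_rpow_of_exponent_le hx (by linarith)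
      have hm : (0 : ℝ) ≤ DirichletDisc.zeroOrder χ ρ := Nat.cast_nonneg _
      calc (DirichletDisc.zeroOrder χ ρ : ℝ) * (x ^ ρ.re / ‖ρ‖)
          ≤ (DirichletDisc.zeroOrder χ ρ : ℝ) * (x ^ (1 / 4 : ℝ) / r₀) := by
            gcongr
        _ = x ^ (1 / 4 : ℝ) / r₀ * (DirichletDisc.zeroOrder χ ρ : ℝ) := by ring
    -- the partners `1 - ρ` and the Jensen count
    have hinj : Set.InjOn (fun ρ : ℂ ↦ 1 - ρ) (R.filter P : Set ℂ) :=
      fun a _ b _ h ↦ by simpa using h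
    have hcount' : ∑ ρ ∈ R.filter P, (DirichletDisc.zeroOrder χ ρ : ℝ) ≤ B := by
      have hsym : ∑ ρ ∈ R.filter P, (DirichletDisc.zeroOrder χ ρ : ℝ) =
          ∑ ρ ∈ R.filter P, (DirichletDisc.zeroOrder χ (1 - ρ) : ℝ) := by
        refine sum_congr rfl fun ρ hρ ↦ ?_
        rw [mem_filter] at hρ
        obtain ⟨-, hre0, hre1, -⟩ := hRmem ρ hρ.1
        rw [zeroOrder_one_sub hprim hquad hχ hre0 hre1]
      have himg : ∑ ρ' ∈ (R.filter P).image (fun ρ : ℂ ↦ 1 - ρ), (DirichletDisc.zeroOrder χ ρ' : ℝ) =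
          ∑ ρ ∈ R.filter P, (DirichletDisc.zeroOrder χ (1 - ρ) : ℝ) := sum_image hinj
      rw [hsym, ← himg]
      refine hcount _ fun ρ' hρ' ↦ ?_
      obtain ⟨ρ, hρ, rfl⟩ := mem_image.1 hρ'
      rw [mem_filter] at hρ
      obtain ⟨hre4, him4⟩ : ρ.re < 1 / 4 ∧ |ρ.im| < 1 / 4 := hρ.2
      obtain ⟨h0, hre0, hre1, -⟩ := hRmem ρ hρ.1
      refine ⟨?_, LFunction_one_sub_eq_zero hprim hquad hχ h0 hre0 hre1⟩
      rw [mem_closedBall, dist_eq_norm]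
      simpa using norm_one_sub_sub_two_le hre0 hre4 him4
    calc ∑ ρ ∈ R.filter P, ‖g ρ‖ ≤ ∑ ρ ∈ R.filter P, x ^ (1 / 4 : ℝ) / r₀ * (DirichletDisc.zeroOrder χ ρ : ℝ) :=
          sum_le_sum hterm
      _ = x ^ (1 / 4 : ℝ) / r₀ * ∑ ρ ∈ R.filter P, (DirichletDisc.zeroOrder χ ρ : ℝ) := by rw [mul_sum]
      _ ≤ x ^ (1 / 4 : ℝ) / r₀ * B := by
          gcongr
  calc ‖∑ ρ ∈ R, g ρ‖ ≤ ∑ ρ ∈ R, ‖g ρ‖ := norm_sum_le _ _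
    _ = ∑ ρ ∈ R.filter P, ‖g ρ‖ + ∑ ρ ∈ R.filter (fun ρ ↦ ¬P ρ), ‖g ρ‖ :=
        (sum_filter_add_sum_filter_not R P _).symm
    _ ≤ x ^ (1 / 4 : ℝ) / r₀ * B + 4 * charZeroPowerSum χ x T {(β : ℂ)} := add_le_add hsmallsum hbig
    _ = 4 * charZeroPowerSum χ x T {(β : ℂ)} + x ^ (1 / 4 : ℝ) / r₀ * B := add_comm _ _

end Literature.NumberTheory.LFunctions.SiegelZero

end
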